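import Summits.AtomisticToContinuum.HydrodynamicLimit.Theorems.HydroLimitInBand.Negative.ShearStream
import Summits.AtomisticToContinuum.HydrodynamicLimit.Theorems.HydroLimitInBand.Negative.LLNZero
import Summits.AtomisticToContinuum.HydrodynamicLimit.Theorems.CorrectorPressureDecay.Negative.FreeFlow
import Summits.AtomisticToContinuum.HydrodynamicLimit.Theorems.DenseExcursion.Negative.AtTimeZero
import Summits.AtomisticToContinuum.HydrodynamicLimit.Theorems.PolynomialCompression.Negative.PdeForm
import HarnessLib

/-!
# `HydroLimitInBand` (crux stmt-AtomisticToContinuum-9133), negative side: TIGHTNESS OF `0 < σ`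

Standing disprover's lemma (`Cruxes/HydroLimitInBand/Disproof.lean` §8, refuter-cdisprove lineage of stmt-9133; the
assembly announced by `Negative/LLNZero.lean` and `Negative/ShearStream.lean`). The free flight at diameter `0` is taken
from the tree (`CorrectorPressureDecayNegative.FreeFlow.freeFlow₀`, reviewer's instruction on p102539).

* `tendsto_momentum_freeStream` — under the local Gibbs laws of the shear equilibrium `(1, sin(2π x₁) e₀, 1)` at `σ = 0`
  (a product law: i.i.d. uniform positions, independent Maxwellian velocities) the coordinate `0` of the empirical
  momentum field of the configuration streamed FREELY for time `t`, tested against `χ = sin(2π ·₁)`, converges in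
  probability to the Knudsen value `e^{-2π²t²}/2` (centred Maxwellian fluctuation with uniform variance bound,
  `tendsto_localGibbsMeasure_velFluct`, plus the i.i.d. position LLN `posLLN_zero` for the streaming mean).
* `HydroLimitInBandWithZero` — the crux with `0 < σ` relaxed to `0 ≤ σ` (everything else verbatim);
  `hydroLimitInBand_of_withZero` — it contains the crux.
* **`hydroLimitInBand_false_with_sigma_zero : ¬ HydroLimitInBandWithZero`** — at `σ = 0` the stationary shear is an
  admissible guarded classical hs-Euler solution (`isHardSphereEulerSolution_shear`, `tendstoHydroFieldsAt_zero_sigma_zero`)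
  and the free flight is a flow family of diameter `hsDiameter 0 N = 0`, so the relaxed crux would make the momentum
  field at `t = 1` follow the stationary shear (value `1/2`), against the free-streaming value `e^{-2π²}/2`; limits in
  probability are unique. HENCE `0 < σ` IS LOAD-BEARING: collisions must enter any proof of the crux quantitatively, and
  the hydrodynamic limit is not uniform down to the ideal gas (for the line `IdeatorOneSketch`: the thresholds `τ₀` of its
  window-LD inputs cannot be uniform in `σ ↓ 0`).
-/

noncomputable section

open MeasureTheory ProbabilityTheory Filter Set Topology Real
open scoped ENNReal NNReal InnerProductSpace

namespace Summit.AtomisticToContinuum.HydrodynamicLimit.Theorems.HydroLimitInBandNegative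

open Literature.MathematicalPhysics.KineticTheory Literature.Analysis.FluidPDE
open Literature.Analysis.FunctionSpaces
open Summit.AtomisticToContinuum.HydrodynamicLimit.Theses.ImplosionDichotomy (HydroLimitInBand)
open CorrectorPressureDecayNegative.FreeFlow (freeFlow₀)

/-! ## §C The momentum field under free streaming of the shear equilibrium -/

/-- The shear profile is continuous. [folklore] -/
theorem continuous_shearProfile : Continuous shearProfile :=
  continuous_sinCircle.comp (continuous_apply 1)

/-- `|sin(2π ·)| ≤ 1` on the circle. [folklore] -/
theorem abs_sinCircle_le_one (b : UnitAddCircle) : |sinCircle b| ≤ 1 := by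
  induction b using QuotientAddGroup.induction_on with
  | H y => rw [sinCircle_coe]; exact Real.abs_sin_le_one _

/-- `|shearProfile| ≤ 1`. [folklore] -/
theorem abs_shearProfile_le_one (x : T3) : |shearProfile x| ≤ 1 := abs_sinCircle_le_one _

/-- The free-streaming (Knudsen) mean of the shear momentum observable at time `t`, as a function of the initial
position: `m_t(x) = e^{-2π²t²} sin²(2π x₁)`. -/
def streamMean (t : ℝ) (x : T3) : ℝ := Real.exp (-(2 * π ^ 2 * t ^ 2)) * shearProfile x ^ 2

/-- `m_t` is continuous. [folklore] -/
theorem continuous_streamMean (t : ℝ) : Continuous (streamMean t) :=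
  continuous_const.mul (continuous_shearProfile.pow 2)

/-- `∫ m_t = e^{-2π²t²}/2`. [folklore] -/
theorem integral_streamMean (t : ℝ) : ∫ x, streamMean t x = Real.exp (-(2 * π ^ 2 * t ^ 2)) * (1 / 2) := by
  unfold streamMean
  rw [integral_const_mul, integral_shearProfile_sq]

/-- The one-particle momentum observable at time `t` minus its Maxwellian mean: `Y_t(x, v) = χ(x + t v) v₀ - m_t(x)`. -/
def streamFluct (t : ℝ) (x : T3) (v : V3) : ℝ := shearProfile (x + Torus.proj (t • v)) * v 0 - streamMean t x

/-- `Y_t` is jointly continuous, hence measurable. [folklore] -/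
theorem measurable_streamFluct (t : ℝ) : Measurable fun p : T3 × V3 => streamFluct t p.1 p.2 := by
  unfold streamFluct
  refine Continuous.measurable ?_
  refine ((continuous_shearProfile.comp ?_).mul ?_).sub ((continuous_streamMean t).comp continuous_fst)
  · exact continuous_fst.add (Torus.continuous_proj.comp (continuous_snd.const_smul t))
  · exact (PiLp.continuous_apply 2 _ (0 : Fin 3)).comp continuous_snd

/-- The raw observable `v ↦ χ(x + t v) v₀` is square integrable under any Maxwellian (`|χ| ≤ 1`, `v₀ ∈ L²`).
[folklore] -/
theorem memLp_stream_obs (t : ℝ) (x : T3) (u : V3) :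
    MemLp (fun v : V3 => shearProfile (x + Torus.proj (t • v)) * v 0) 2 (gaussMeasure u 1) := by
  refine (memLp_coord_gaussMeasure u 1 (0 : Fin 3) 2 (by simp)).of_le_mul (c := 1) ?_ ?_
  · exact (((continuous_shearProfile.comp (continuous_const.add (Torus.continuous_proj.comp
      (continuous_id.const_smul t)))).mul (PiLp.continuous_apply 2 _ (0 : Fin 3))).aestronglyMeasurable)
  · refine Eventually.of_forall fun v => ?_
    rw [Real.norm_eq_abs, Real.norm_eq_abs, abs_mul, one_mul]
    exact mul_le_of_le_one_left (abs_nonneg _) (abs_shearProfile_le_one _)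

/-- `Y_t(x, ·)` is square integrable under the Maxwellian of the shear state at `x`. [folklore] -/
theorem memLp_streamFluct (t : ℝ) (x : T3) :
    MemLp (streamFluct t x) 2 (gaussMeasure (shearVelocity x) 1) :=
  (memLp_stream_obs t x _).sub (memLp_const _)

/-- **`Y_t(x, ·)` is centred** (this is `integral_shear_stream`). [folklore] -/
theorem integral_streamFluct (t : ℝ) (x : T3) : ∫ v, streamFluct t x v ∂gaussMeasure (shearVelocity x) 1 = 0 := by
  unfold streamFluct
  rw [integral_sub ((memLp_stream_obs t x _).integrable one_le_two) (integrable_const _), integral_shear_stream,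
    integral_const]
  simp [streamMean]

/-- **Uniform variance bound**: `Var Y_t(x, ·) ≤ 2` (`≤ E v₀² = 1 + sin²(2π x₁)`). [folklore] -/
theorem variance_streamFluct_le (t : ℝ) (x : T3) : Var[streamFluct t x; gaussMeasure (shearVelocity x) 1] ≤ 2 := by
  set γ := gaussMeasure (shearVelocity x) 1 with hγ
  have hobs := memLp_stream_obs t x (shearVelocity x)
  have h0 : MemLp (fun v : V3 => v 0) 2 γ := memLp_coord_gaussMeasure _ 1 (0 : Fin 3) 2 (by simp)
  unfold streamFluct
  rw [variance_sub_const hobs.aestronglyMeasurable]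
  calc Var[fun v : V3 => shearProfile (x + Torus.proj (t • v)) * v 0; γ]
      ≤ γ[(fun v : V3 => shearProfile (x + Torus.proj (t • v)) * v 0) ^ 2] :=
        variance_le_expectation_sq hobs.aestronglyMeasurable
    _ ≤ γ[(fun v : V3 => v 0) ^ 2] := by
        refine integral_mono hobs.integrable_sq h0.integrable_sq fun v => ?_
        simp only [Pi.pow_apply]
        rw [mul_pow]
        refine mul_le_of_le_one_left (sq_nonneg _) ?_
        have h1 := abs_shearProfile_le_one (x + Torus.proj (t • v))
        rw [← sq_abs]
        nlinarith [abs_nonneg (shearProfile (x + Torus.proj (t • v)))]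
    _ = Var[fun v : V3 => v 0; γ] + (γ[fun v : V3 => v 0]) ^ 2 := by
        rw [variance_eq_sub h0]; ring
    _ = 1 + shearProfile x ^ 2 := by
        rw [hγ, variance_coord_gaussMeasure _ zero_le_one, integral_coord_gaussMeasure _ one_pos]
        simp
    _ ≤ 2 := by
        have h1 := abs_shearProfile_le_one x
        rw [← sq_abs]
        nlinarith [abs_nonneg (shearProfile x)]

/-- The coordinate `0` of the empirical momentum field of the FREELY STREAMED configuration, tested against the shear
profile, as an average over the initial data. [folklore] -/
theorem empiricalMomentumField_freeFlight_zero {N : ℕ} (t : ℝ) (z : Config N (Fin 3) T3) :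
    empiricalMomentumField (freeFlight (Torus.geometry (Fin 3)) t z) shearProfile 0 =
      (N : ℝ)⁻¹ * ∑ i, shearProfile ((z i).1 + Torus.proj (t • (z i).2)) * (z i).2 0 := by
  rw [empiricalMomentumField_eq_sum]
  simp only [PiLp.smul_apply, WithLp.ofLp_sum, Finset.sum_apply, smul_eq_mul]
  rfl

/-- The fluctuation / position-functional SPLIT of the streamed momentum coordinate. [folklore] -/
theorem stream_split {N : ℕ} (t : ℝ) (z : Config (N + 1) (Fin 3) T3) :
    ((N + 1 : ℕ) : ℝ)⁻¹ * ∑ i, streamFluct t (z i).1 (z i).2 +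
        (((N + 1 : ℕ) : ℝ)⁻¹ * ∑ i, streamMean t (z i).1 - ∫ y, streamMean t y) =
      empiricalMomentumField (freeFlight (Torus.geometry (Fin 3)) t z) shearProfile 0 -
        Real.exp (-(2 * π ^ 2 * t ^ 2)) * (1 / 2) := by
  rw [empiricalMomentumField_freeFlight_zero, integral_streamMean]
  simp only [streamFluct, Finset.sum_sub_distrib, mul_sub]
  ring

/-- **The momentum field of the freely streamed shear equilibrium converges to its KNUDSEN value.** Under the local
Gibbs laws of the shear profile at `σ = 0` (a product law), the coordinate `0` of the empirical momentum field of the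
configuration streamed freely for time `t`, tested against `χ = sin(2π ·₁)`, converges in probability to
`e^{-2π²t²}/2` — NOT to the Euler value `1/2` (the shear is a stationary Euler solution) unless `t = 0`. Proof: per
particle the observable splits into the centred Maxwellian fluctuation `Y_t` (uniform variance bound; conditionally on
the positions an average of independent terms, `tendsto_localGibbsMeasure_velFluct`) plus the continuous position
functional `m_t(xᵢ)`, whose average obeys the i.i.d. uniform position LLN (`posLLN_zero`). [folklore] -/
theorem tendsto_momentum_freeStream (t : ℝ) {δ : ℝ} (hδ : 0 < δ) :
    Tendsto (fun N : ℕ => localGibbsMeasure 0 (fun _ => 1) shearVelocity (fun _ => 1) N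
      {z | δ < |empiricalMomentumField (freeFlight (Torus.geometry (Fin 3)) t z) shearProfile 0 -
        Real.exp (-(2 * π ^ 2 * t ^ 2)) * (1 / 2)|}) atTop (𝓝 0) := by
  have hA := tendsto_localGibbsMeasure_velFluct (a₀ := fun _ => (1 : ℝ)) (θ₀ := fun _ => (1 : ℝ))
    (u₀ := shearVelocity) continuous_const continuous_const continuous_shearVelocity (fun _ => one_pos)
    (fun _ => one_pos) (σ := 0) (by norm_num) (Y := streamFluct t) (measurable_streamFluct t)
    (fun x => memLp_streamFluct t x) (fun x => integral_streamFluct t x) (B := 2)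
    (fun x => variance_streamFluct_le t x) (χ := fun _ => (1 : ℝ)) continuous_const (η := δ / 2) (by positivity)
  have hB := tendsto_localGibbsMeasure_densityEvent (a₀ := fun _ => (1 : ℝ)) (θ₀ := fun _ => (1 : ℝ))
    (u₀ := shearVelocity) continuous_const continuous_const continuous_shearVelocity (fun _ => zero_le_one)
    (fun _ => one_pos) 0 (ρ₀ := fun _ => (1 : ℝ)) (fun χ hχ δ' hδ' => posLLN_zero hχ hδ')
    (g := streamMean t) (continuous_streamMean t) (η := δ / 2) (by positivity)
  have hAB := tendsto_measure_lt_abs_add hA hB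
  refine hAB.congr fun N => ?_
  congr 1
  ext z
  simp only [mem_setOf_eq, one_mul, mul_one]
  rw [stream_split t z, show (2 : ℝ) * (δ / 2) = δ by ring]

/-! ## §E Tightness of `0 < σ`: the crux with `0 ≤ σ` is FALSE -/

/-- The crux `HydroLimitInBand` with the strict positivity `0 < σ` of the reduced density relaxed to `0 ≤ σ`
(everything else verbatim). -/
def HydroLimitInBandWithZero : Prop :=
  ∃ η₀ : ℝ, 0 < η₀ ∧ ∀ (a₀ θ₀ : T3 → ℝ) (u₀ : T3 → V3), Continuous a₀ → Continuous θ₀ → Continuous u₀ →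
    (∀ x, 0 < a₀ x) → (∀ x, 0 < θ₀ x) → ∃ σ₀ : ℝ, 0 < σ₀ ∧ ∀ σ : ℝ, 0 ≤ σ → σ < σ₀ →
    ∀ (T : ℝ) (ρ θ : ℝ → T3 → ℝ) (u : ℝ → T3 → V3), IsHardSphereEulerSolution σ T ρ u θ →
    (∀ t ∈ Ico 0 T, ∀ x, ρ t x * σ ^ 3 < η₀) →
    ∀ Φ : (N : ℕ) → HardSphereFlow (Torus.geometry (Fin 3)) (hsDiameter σ N) (N + 1),
    TendstoHydroFieldsAt (fun N => localGibbsLaw σ a₀ u₀ θ₀ N (Φ N)) Φ ρ u θ 0 →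
    ∀ t ∈ Ico 0 T, TendstoHydroFieldsAt (fun N => localGibbsLaw σ a₀ u₀ θ₀ N (Φ N)) Φ ρ u θ t

/-- The relaxed statement trivially contains the crux (so `¬ HydroLimitInBandWithZero` is the STRONGEST form in which
the positivity of `σ` can be shown load-bearing). [folklore] -/
theorem hydroLimitInBand_of_withZero (h : HydroLimitInBandWithZero) : HydroLimitInBand := by
  obtain ⟨η₀, hη₀, H⟩ := h
  refine ⟨η₀, hη₀, fun a₀ θ₀ u₀ ha hθ hu ha0 hθ0 => ?_⟩
  obtain ⟨σ₀, hσ₀, G⟩ := H a₀ θ₀ u₀ ha hθ hu ha0 hθ0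
  exact ⟨σ₀, hσ₀, fun σ hσ hσ' => G σ hσ.le hσ'⟩

/-- The Euler value of the shear momentum field tested against the shear profile: `1/2`. [folklore] -/
theorem integral_shear_momentum_target_zero :
    (∫ x : T3, (shearProfile x * (1 : ℝ)) • shearVelocity x) 0 = 1 / 2 := by
  rw [PolynomialCompressionPDE.integral_apply_coord (F := fun x => (shearProfile x * (1 : ℝ)) • shearVelocity x)
    (integrable_of_continuous_T3 ((continuous_shearProfile.mul continuous_const).smul continuous_shearVelocity))]
  simp only [mul_one, PiLp.smul_apply, smul_eq_mul, shearVelocity_apply, ↓reduceIte]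
  rw [← integral_shearProfile_sq]
  exact integral_congr_ae (Eventually.of_forall fun x => by simp only [sq])

/-- **TIGHTNESS OF `0 < σ` — the crux with `0 ≤ σ` is FALSE: collisions are load-bearing.** At reduced density
`σ = 0` the spheres have diameter `hsDiameter 0 N = 0`: the local Gibbs law of the shear equilibrium
`(1, sin(2π x₁) e₀, 1)` is a product law, the dynamics is the FREE FLIGHT (`freeFlow₀` of the tree, a hard-sphere flow of
diameter `0`), the stationary shear IS a classical (guarded, packing `0 < η₀`) hs-Euler solution at `σ = 0` tied to the
data at `t = 0` (`tendstoHydroFieldsAt_zero_sigma_zero`), so `HydroLimitInBandWithZero` would force the empirical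
momentum field at `t = 1` to follow the STATIONARY shear (value `1/2` against `χ = sin(2π ·₁)`), whereas free streaming
(Knudsen gas) gives the Gaussian-damped value `e^{-2π²}/2` (`tendsto_momentum_freeStream`); limits in probability are
unique and `e^{-2π²} < 1`. So any proof of the crux must use `0 < σ` QUANTITATIVELY (through collisions); the
hydrodynamic limit is not uniform down to the ideal gas. [folklore] -/
theorem hydroLimitInBand_false_with_sigma_zero : ¬ HydroLimitInBandWithZero := by
  rintro ⟨η₀, hη₀, H⟩
  obtain ⟨σ₀, hσ₀, G⟩ := H (fun _ => 1) (fun _ => 1) shearVelocity continuous_const continuous_const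
    continuous_shearVelocity (fun _ => one_pos) (fun _ => one_pos)
  have hE := isHardSphereEulerSolution_shear 0 2
  have hguard : ∀ s ∈ Ico (0 : ℝ) 2, ∀ x : T3, (fun (_ : ℝ) (_ : T3) => (1 : ℝ)) s x * (0 : ℝ) ^ 3 < η₀ :=
    fun _ _ _ => by simpa using hη₀
  have h0 := tendstoHydroFieldsAt_zero_sigma_zero (θ₀ := fun _ => 1) (u₀ := shearVelocity) continuous_const
    continuous_shearVelocity (fun _ => one_pos) freeFlow₀
  have h1 := G 0 le_rfl hσ₀ 2 (fun _ _ => 1) (fun _ _ => 1) (fun _ x => shearVelocity x) hE hguard freeFlow₀ h0 1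
    ⟨by norm_num, by norm_num⟩
  set I : V3 := ∫ x : T3, (shearProfile x * (1 : ℝ)) • shearVelocity x with hI
  have hI0 : I 0 = 1 / 2 := integral_shear_momentum_target_zero
  -- the Euler value of the momentum field (coordinate `0`) at `t = 1`, from the relaxed crux
  have hconv : ∀ δ > (0 : ℝ), Tendsto (fun N : ℕ => localGibbsMeasure 0 (fun _ => 1) shearVelocity (fun _ => 1) N
      {z | δ < |empiricalMomentumField (freeFlight (Torus.geometry (Fin 3)) 1 z) shearProfile 0 - 1 / 2|})
      atTop (𝓝 0) := by
    intro δ hδ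
    obtain ⟨-, hm, -⟩ := h1 shearProfile continuous_shearProfile δ hδ
    refine tendsto_of_tendsto_of_tendsto_of_le_of_le tendsto_const_nhds hm (fun N => bot_le) (fun N => ?_)
    beta_reduce
    rw [localGibbsLaw_eq]
    refine measure_mono fun z hz => ?_
    simp only [mem_setOf_eq] at hz
    show δ < ‖empiricalMomentumField (freeFlight (Torus.geometry (Fin 3)) 1 z) shearProfile - I‖
    calc δ < |empiricalMomentumField (freeFlight (Torus.geometry (Fin 3)) 1 z) shearProfile 0 - 1 / 2| := hz
      _ = |(empiricalMomentumField (freeFlight (Torus.geometry (Fin 3)) 1 z) shearProfile - I) 0| := by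
          rw [PiLp.sub_apply, hI0]
      _ ≤ _ := by
          have h := PiLp.norm_apply_le
            (empiricalMomentumField (freeFlight (Torus.geometry (Fin 3)) 1 z) shearProfile - I) 0
          rwa [Real.norm_eq_abs] at h
  -- the Knudsen value, from free streaming
  have hK : ∀ δ > (0 : ℝ), Tendsto (fun N : ℕ => localGibbsMeasure 0 (fun _ => 1) shearVelocity (fun _ => 1) N
      {z | δ < |empiricalMomentumField (freeFlight (Torus.geometry (Fin 3)) 1 z) shearProfile 0 -
        Real.exp (-(2 * π ^ 2 * 1 ^ 2)) * (1 / 2)|}) atTop (𝓝 0) := fun δ hδ => tendsto_momentum_freeStream 1 hδ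
  have hP : ∀ᶠ N : ℕ in atTop,
      IsProbabilityMeasure (localGibbsMeasure 0 (fun _ => (1 : ℝ)) shearVelocity (fun _ => 1) N) :=
    Eventually.of_forall fun N => isProbabilityMeasure_localGibbsMeasure continuous_const continuous_const
      continuous_shearVelocity (fun _ => one_pos) (fun _ => one_pos) (by norm_num) N
  have heq := DenseExcursionAtTimeZero.eq_of_tendsto_measure_lt_abs hP
    (F := fun N z => empiricalMomentumField (freeFlight (Torus.geometry (Fin 3)) 1 z) shearProfile 0) hconv hK
  have hlt : Real.exp (-(2 * π ^ 2 * 1 ^ 2)) < 1 := by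
    rw [Real.exp_lt_one_iff]
    have hπ := Real.pi_pos
    nlinarith
  -- `heq : 1/2 = e^{-2π²} · (1/2)` contradicts `e^{-2π²} < 1`
  have h2 : Real.exp (-(2 * π ^ 2 * 1 ^ 2)) = 1 := by linear_combination (-2 : ℝ) * heq
  exact absurd h2 hlt.ne

end Summit.AtomisticToContinuum.HydrodynamicLimit.Theorems.HydroLimitInBandNegative

end
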